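import Mathlib
import HarnessLib
import Summits.HubbardSuperconductivity.HubbardSuperconductivity.Theorems.KLProgrammeKLRegimeEngineIsoLineNumeral
import Summits.HubbardSuperconductivity.HubbardSuperconductivity.Theorems.KLProgrammeKLRegimeEngineIsoTupleExportWBase
import Summits.HubbardSuperconductivity.HubbardSuperconductivity.Theorems.KLProgrammeKLRegimeEngineIsoLineTransport

/-!
# Route `KLProgramme` — ENGINE item stmt-HubbardSuperconductivity-20437, class #6 / (E5-F)ₙ producer, route (M), (R1) NUMERALS (part 3):
# the class-#6 / (E5-F)ₙ / (X).2 CLOSERS with absolute numerals — `a = 2⁹·c_B + 2¹⁷·c_M`, `b = 2¹⁷·c_M′`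

Cell gate-hubbard-kl, seat hubbard-kl-k3c2-p2 (g12; owner-designate of M1 + M3 of route (M), pen (R59az)).  The packagings of …EngineIsoLineAssembly §4–§5 re-run on the
numeral line `fixedTupleL1_klIsoKernelAt_le_numeral_klEng` (`≤ 2⁹·B + 2¹⁷·X` at every resolution, …EngineIsoLineNumeral), so that the remaining inputs of route (M) are exactly:
the value datum (`c_B`, or the lower bound `θ` in the `∀B` form), M2's moment line at every resolution `n ≤ m ≤ n_β` (`c_M`, `c_M′`), and ONE numeric fit against `CF`.

* **`isoTupleLineAt_of_valueLine_momentLine_numeral`** — value line `≤ c_B·U` + moment line `X_m ≤ c_M·U + c_M′·(Klam U)²` ⇒ `IsoTupleLineAt L M (2⁹c_B + 2¹⁷c_M) (2¹⁷c_M′) P β U μ n`;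
* **`isoTupleL1AtV17F_of_momentLine_of_lowValue_numeral`** — moment line + ONE lower bound `θ·U ≤ ‖λ_n[K_n](k₁,k₂,k₃)‖` + fits `2⁹ + 2¹⁷c_M/θ ≤ CF`, `2¹⁷c_M′ ≤ CF` ⇒ `IsoTupleL1AtV17F … n`;
* **`exists_isoPkgW_of_valueLine_momentLine_numeral`** — the (X).2 conjunct at any `CF` from the value line, the moment line and the fit of `(2⁹c_B + 2¹⁷c_M, 2¹⁷c_M′, u)`.
* §3 (appended) **`fixedTupleL1_klIsoKernelAt_le_numeral_atScale_klEng`** — moments at resolution `n` only: `≤ (1 + 9⁴·klIsoT⁴)(2⁹B + 2¹⁷X)` for every `m ≥ n`.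
* §2 (appended) `two_pow_eighty_le_klEngGeo8_CF`, **`isoTupleL1AtV17F_klEngGeo8_of_momentLine_of_lowValue_numeral`** — (E5-F)ₙ at `klEngGeo8` under the NUMERIC fits `2¹⁷c_M ≤ (2^80 − 2⁹)θ`, `c_M′ ≤ 2^63`.

Everything is proved; no definitions; nothing about the model is asserted.  References: BGM 2006 §2.7 (2.69)–(2.71a) [cite: BenfattoGiulianiMastropietro2006].
-/

noncomputable section

namespace Summit.HubbardSuperconductivity.HubbardSuperconductivity.Theorems.EngineV8

set_option linter.dupNamespace false -- summit = problem name (single-conjunct summit), D-0017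

open Set Finset Literature.MathematicalPhysics.QuantumLattice Literature.MathematicalPhysics.QuantumLattice.BandSectorCounting
open Literature.MathematicalPhysics.QuantumLattice.FermiRG Literature.Probability.LatticeModels Literature.Analysis.SpecialFunctions
open Summit.HubbardSuperconductivity.HubbardSuperconductivity.Theorems.DispersionFlow
open Summit.HubbardSuperconductivity.HubbardSuperconductivity.Theorems.KLRegimeSplit
open Summit.HubbardSuperconductivity.HubbardSuperconductivity.Theorems.KLProgrammeLegKernels
open Summit.HubbardSuperconductivity.HubbardSuperconductivity.Theorems.PerturbedFermiCurve
open Summit.HubbardSuperconductivity.HubbardSuperconductivity.Theorems.TorusFourierL2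
open scoped Real

open Classical

variable {L M : ℕ} [NeZero L] [NeZero M]

/-- **`IsoTupleLineAt` WITH NUMERALS** (stub binders; `K := K_n`, `1 ≤ n`): a value line `≤ c_B·U` and a moment line `Λ_m·Mom ≤ c_M·U + c_M′(Klam U)²` at every active resolution
`n ≤ m ≤ n_β` give `IsoTupleLineAt L M (2⁹·c_B + 2¹⁷·c_M) (2¹⁷·c_M′) P β U μ n`. -/
theorem isoTupleLineAt_of_valueLine_momentLine_numeral (P : SplitConsts) (R : RenConsts) (c : ℝ) (hR2 : R.WF2) (hc : 0 < c) (hc3 : c ≤ klEngC₃3 P R)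
    {μ : ℝ} (hμ : μ ∈ klWindowC) {U : ℝ} (hU : 0 < U) (hU3 : U ≤ klEngU₀3 P R c) {β : ℝ} (hβmin : klBetaMin ≤ β) (hβc : β ≤ Real.exp (c / U ^ 2))
    (hL3 : klEngL₃ β U ≤ L) (hM3 : klEngM₃ β U L ≤ M) {n : ℕ} (hn1 : 1 ≤ n) (hK : FrameOK R U (nScales β) μ (klFlowFrameU L M β U μ n))
    {cB cM cM' : ℝ} (hcB : 0 ≤ cB) (hcM : 0 ≤ cM) (hcM' : 0 ≤ cM')
    (hval : ∀ k₁ ∈ klBall L μ 0, ∀ k₂ ∈ klBall L μ 0, ∀ k₃ ∈ klBall L μ 0,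
      ‖klQuarticValue L M β U μ (klFlowFrameU L M β U μ n) n 0 1 k₁ k₂ k₃‖ ≤ cB * U)
    (hmom : ∀ m : ℕ, n ≤ m → m ≤ nScales β → ∀ (ω : Fin 4 → Fin (sectorCount (2 * m))) (x₁ : SpaceTimeIdx L M) (j : Fin 3),
      klScale klE0 m * (imagTimeWeight β M ^ 3 * ∑ y : Fin 3 → SpaceTimeIdx L M,
        spaceTimeDist L M β x₁ (y j) *
          ‖klIsoKernelAt L M β U μ (klFlowFrameU L M β U μ n) n m (fun i => ((ω i, ![(0 : Fin 2), 0, 1, 1] i), ![(0 : Fin 2), 1, 0, 1] i))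
            (Matrix.vecCons x₁ y)‖) ≤ cM * U + cM' * (P.Klam * U) ^ 2) :
    IsoTupleLineAt L M (2 ^ 9 * cB + 2 ^ 17 * cM) (2 ^ 17 * cM') P β U μ n := by
  intro m hnm Ω _ x₁
  have hm1 : 1 ≤ m := hn1.trans hnm
  have hB0 : 0 ≤ cB * U := mul_nonneg hcB hU.le
  have hX0 : 0 ≤ cM * U + cM' * (P.Klam * U) ^ 2 := by positivity
  have hb := fixedTupleL1_klIsoKernelAt_le_numeral_klEng P R c hR2 hc hc3 hμ hU hU3 hβmin hβc hK hL3 hM3 n hm1 hB0 hX0 hval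
    (fun hmN => hmom m hnm hmN) Ω x₁
  refine hb.trans (le_of_eq ?_)
  ring

/-- **(E5-F)ₙ WITH NUMERALS from the moment line and ONE value lower bound** (stub binders; `1 ≤ n`; `0 < θ`): the moment line at every active resolution, a lower bound
`θ·U ≤ ‖λ_n[K_n](k₁,k₂,k₃)‖` at one bare-ball triple and the fits `2⁹ + 2¹⁷·c_M/θ ≤ CF`, `2¹⁷·c_M′ ≤ CF` give `IsoTupleL1AtV17F L M G P β U μ n`. -/
theorem isoTupleL1AtV17F_of_momentLine_of_lowValue_numeral {G : GeoConsts} (P : SplitConsts) (R : RenConsts) (c : ℝ) (hR2 : R.WF2) (hc : 0 < c)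
    (hc3 : c ≤ klEngC₃3 P R) {μ : ℝ} (hμ : μ ∈ klWindowC) {U : ℝ} (hU : 0 < U) (hU3 : U ≤ klEngU₀3 P R c) {β : ℝ} (hβmin : klBetaMin ≤ β)
    (hβc : β ≤ Real.exp (c / U ^ 2)) (hL3 : klEngL₃ β U ≤ L) (hM3 : klEngM₃ β U L ≤ M) {n : ℕ} (hn1 : 1 ≤ n)
    (hK : FrameOK R U (nScales β) μ (klFlowFrameU L M β U μ n)) {cM cM' θ : ℝ} (hcM : 0 ≤ cM) (hcM' : 0 ≤ cM') (hθ : 0 < θ)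
    (hfitA : 2 ^ 9 + 2 ^ 17 * cM / θ ≤ G.CF) (hfitb : 2 ^ 17 * cM' ≤ G.CF)
    (hmom : ∀ m : ℕ, n ≤ m → m ≤ nScales β → ∀ (ω : Fin 4 → Fin (sectorCount (2 * m))) (x₁ : SpaceTimeIdx L M) (j : Fin 3),
      klScale klE0 m * (imagTimeWeight β M ^ 3 * ∑ y : Fin 3 → SpaceTimeIdx L M,
        spaceTimeDist L M β x₁ (y j) *
          ‖klIsoKernelAt L M β U μ (klFlowFrameU L M β U μ n) n m (fun i => ((ω i, ![(0 : Fin 2), 0, 1, 1] i), ![(0 : Fin 2), 1, 0, 1] i))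
            (Matrix.vecCons x₁ y)‖) ≤ cM * U + cM' * (P.Klam * U) ^ 2)
    {k₁ k₂ k₃ : TorusSite 2 L} (hk₁ : k₁ ∈ klBall L μ 0) (hk₂ : k₂ ∈ klBall L μ 0) (hk₃ : k₃ ∈ klBall L μ 0)
    (hlow : θ * U ≤ ‖klQuarticValue L M β U μ (klFlowFrameU L M β U μ n) n 0 1 k₁ k₂ k₃‖) :
    IsoTupleL1AtV17F L M G P β U μ n := by
  refine isoTupleL1AtV17F_of_threeConst_le (A := 2 ^ 9) (a' := 2 ^ 17 * cM) (b' := 2 ^ 17 * cM') hθ (by positivity) ?_ hk₁ hk₂ hk₃ hlow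
    hfitA hfitb
  intro B hB0 hvals m hnm Ω _ x₁
  have hm1 : 1 ≤ m := hn1.trans hnm
  have hX0 : 0 ≤ cM * U + cM' * (P.Klam * U) ^ 2 := by positivity
  have hb := fixedTupleL1_klIsoKernelAt_le_numeral_klEng P R c hR2 hc hc3 hμ hU hU3 hβmin hβc hK hL3 hM3 n hm1 hB0 hX0 hvals
    (fun hmN => hmom m hnm hmN) Ω x₁
  refine hb.trans (le_of_eq ?_)
  ring

/-- **(X).2 WITH NUMERALS** (any `CF`, any table `Q`, any threshold `u` with `0 < u cc`): under the W-Step's binders the value line `≤ c_B·U` and the moment line at every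
active resolution, together with the fit of the package `(2⁹c_B + 2¹⁷c_M, 2¹⁷c_M′, u)` against `CF`, give `∃ e, IsIsoPkgW P CF e ∧ IsoTupleLineStepW P R Q e.1 e.2.1 e.2.2`. -/
theorem exists_isoPkgW_of_valueLine_momentLine_numeral (P : SplitConsts) (R : RenConsts) (hP : P.WF) (hR2 : R.WF2) (Q : EngConsts) {CF cB cM cM' : ℝ}
    {u : ℝ → ℝ} (hcB : 0 ≤ cB) (hcM : 0 ≤ cM) (hcM' : 0 ≤ cM') (hupos : ∀ cc, 0 < u cc)
    (hfit : ∀ cc, max (2 ^ 9 * cB + 2 ^ 17 * cM) (klIsoT ^ 4 / 2) + max (2 ^ 17 * cM') (klIsoT ^ 4 * klScaleZeroValC R / 192) * P.Klam ^ 2 * u cc ≤ CF / 2)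
    (hdata : ∀ cc : ℝ, 0 < cc → cc ≤ klEngC₃6 P R → ∀ μ ∈ klWindowC, ∀ U : ℝ, 0 < U → U ≤ klEngU₀10 P R cc → U ≤ u cc →
      ∀ β : ℝ, klBetaMin ≤ β → β ≤ Real.exp (cc / U ^ 2) → ∀ (L M : ℕ) [NeZero L] [NeZero M], klEngL₄ P R β U ≤ L → klEngM₃ β U L ≤ M →
      ∀ n : ℕ, 1 ≤ n → n ≤ nScales β + 1 → IsKLRegime U cc (-(n : ℤ)) → FrameOK R U (nScales β) μ (klFlowFrameU L M β U μ n) →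
      (∀ k₁ ∈ klBall L μ 0, ∀ k₂ ∈ klBall L μ 0, ∀ k₃ ∈ klBall L μ 0,
          ‖klQuarticValue L M β U μ (klFlowFrameU L M β U μ n) n 0 1 k₁ k₂ k₃‖ ≤ cB * U) ∧
        (∀ m : ℕ, n ≤ m → m ≤ nScales β → ∀ (ω : Fin 4 → Fin (sectorCount (2 * m))) (x₁ : SpaceTimeIdx L M) (j : Fin 3),
          klScale klE0 m * (imagTimeWeight β M ^ 3 * ∑ y : Fin 3 → SpaceTimeIdx L M,
            spaceTimeDist L M β x₁ (y j) *
              ‖klIsoKernelAt L M β U μ (klFlowFrameU L M β U μ n) n m (fun i => ((ω i, ![(0 : Fin 2), 0, 1, 1] i), ![(0 : Fin 2), 1, 0, 1] i))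
                (Matrix.vecCons x₁ y)‖) ≤ cM * U + cM' * (P.Klam * U) ^ 2)) :
    ∃ e : ℝ × ℝ × (ℝ → ℝ), IsIsoPkgW P CF e ∧ IsoTupleLineStepW P R Q e.1 e.2.1 e.2.2 := by
  refine exists_isoPkgW_of_isoLine P R hP hR2 Q hupos hfit ?_
  intro cc hcc hcc6 μ hμ U hU hU10 hUu β hβ hβc L M _ _ hL hM n hn1 hn hreg hK
  obtain ⟨hval, hmom⟩ := hdata cc hcc hcc6 μ hμ U hU hU10 hUu β hβ hβc L M hL hM n hn1 hn hreg hK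
  exact isoTupleLineAt_of_valueLine_momentLine_numeral P R cc hR2 hcc (hcc6.trans (klEngC₃6_le_klEngC₃3 P R)) hμ hU
    (hU10.trans (klEngU₀10_le_klEngU₀3 P R cc)) hβ hβc (klEngL₃_le_of_klEngL₄_le hL) hM hn1 hK hcB hcM hcM' hval hmom

/-! ## §2 (appended) At the frozen geometry package: `klEngGeo8.CF ≥ 2^80` -/

/-- **`2^80 ≤ klEngGeo8.CF`** (`klEngGeo8.CF = 2^28·klEngGeo4.CF`, `klEngGeo4.CF = max (2^52) (klIsoT⁴)`). -/
theorem two_pow_eighty_le_klEngGeo8_CF : (2 : ℝ) ^ 80 ≤ klEngGeo8.CF := by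
  have h : klEngGeo8.CF = 2 ^ 28 * klEngGeo4.CF := by
    rw [klEngGeo8_CF, klEngGeo7_CF, klEngGeo6_CF, klEngGeo5_CF]
  rw [h, show (2 : ℝ) ^ 80 = 2 ^ 28 * 2 ^ 52 by norm_num]
  exact mul_le_mul_of_nonneg_left two_pow_le_klEngGeo4_CF (by positivity)

/-- **(E5-F)ₙ AT `klEngGeo8` WITH NUMERALS** (stub binders; `1 ≤ n`): the moment line at every active resolution with constants `c_M, c_M′`, one value lower bound
`θ·U ≤ ‖λ_n[K_n](k₁,k₂,k₃)‖` (`0 < θ`), and the NUMERIC fits `2¹⁷·c_M ≤ (2^80 − 2⁹)·θ`, `c_M′ ≤ 2^63` give `IsoTupleL1AtV17F L M klEngGeo8 P β U μ n`. -/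
theorem isoTupleL1AtV17F_klEngGeo8_of_momentLine_of_lowValue_numeral (P : SplitConsts) (R : RenConsts) (c : ℝ) (hR2 : R.WF2) (hc : 0 < c)
    (hc3 : c ≤ klEngC₃3 P R) {μ : ℝ} (hμ : μ ∈ klWindowC) {U : ℝ} (hU : 0 < U) (hU3 : U ≤ klEngU₀3 P R c) {β : ℝ} (hβmin : klBetaMin ≤ β)
    (hβc : β ≤ Real.exp (c / U ^ 2)) (hL3 : klEngL₃ β U ≤ L) (hM3 : klEngM₃ β U L ≤ M) {n : ℕ} (hn1 : 1 ≤ n)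
    (hK : FrameOK R U (nScales β) μ (klFlowFrameU L M β U μ n)) {cM cM' θ : ℝ} (hcM : 0 ≤ cM) (hcM' : 0 ≤ cM') (hθ : 0 < θ)
    (hfitA : 2 ^ 17 * cM ≤ (2 ^ 80 - 2 ^ 9) * θ) (hfitb : cM' ≤ 2 ^ 63)
    (hmom : ∀ m : ℕ, n ≤ m → m ≤ nScales β → ∀ (ω : Fin 4 → Fin (sectorCount (2 * m))) (x₁ : SpaceTimeIdx L M) (j : Fin 3),
      klScale klE0 m * (imagTimeWeight β M ^ 3 * ∑ y : Fin 3 → SpaceTimeIdx L M,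
        spaceTimeDist L M β x₁ (y j) *
          ‖klIsoKernelAt L M β U μ (klFlowFrameU L M β U μ n) n m (fun i => ((ω i, ![(0 : Fin 2), 0, 1, 1] i), ![(0 : Fin 2), 1, 0, 1] i))
            (Matrix.vecCons x₁ y)‖) ≤ cM * U + cM' * (P.Klam * U) ^ 2)
    {k₁ k₂ k₃ : TorusSite 2 L} (hk₁ : k₁ ∈ klBall L μ 0) (hk₂ : k₂ ∈ klBall L μ 0) (hk₃ : k₃ ∈ klBall L μ 0)
    (hlow : θ * U ≤ ‖klQuarticValue L M β U μ (klFlowFrameU L M β U μ n) n 0 1 k₁ k₂ k₃‖) :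
    IsoTupleL1AtV17F L M klEngGeo8 P β U μ n := by
  have hCF := two_pow_eighty_le_klEngGeo8_CF
  refine isoTupleL1AtV17F_of_momentLine_of_lowValue_numeral P R c hR2 hc hc3 hμ hU hU3 hβmin hβc hL3 hM3 hn1 hK hcM hcM' hθ ?_ ?_ hmom
    hk₁ hk₂ hk₃ hlow
  · have h1 : 2 ^ 9 + 2 ^ 17 * cM / θ ≤ 2 ^ 80 := by
      rw [add_comm, ← le_sub_iff_add_le, div_le_iff₀ hθ]
      exact hfitA
    exact h1.trans hCF
  · have h2 : (2 : ℝ) ^ 17 * cM' ≤ 2 ^ 80 := by nlinarith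
    exact h2.trans hCF

/-! ## §3 (appended) Moments at the kernel's own resolution only: numerals × the transport factor -/

/-- **THE ISO LINE AT EVERY `m ≥ n` FROM THE MOMENTS AT RESOLUTION `n`, NUMERAL FORM** (stub binders with `P.WF`; `1 ≤ n`): with `B` the value bound and `X` the
moment budget of the standard tuples AT RESOLUTION `n`, `fixedTupleL1 β 3 (klIsoKernelAt … K n m) Ω x₁ ≤ (1 + 9⁴·klIsoT⁴)·(2⁹·B + 2¹⁷·X)` for every `m ≥ n`, `Ω`, `x₁`
(`m = n`: `fixedTupleL1_klIsoKernelAt_le_numeral_klEng`; `m ≥ n+1`: transport `fixedTupleL1_klIsoKernelAt_le_of_coarser_klEng`).  The factor `klIsoT⁴` is opaque (CF-keyed):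
see ROUTE-M-FIT.md for why M2 at every resolution is preferred. -/
theorem fixedTupleL1_klIsoKernelAt_le_numeral_atScale_klEng (P : SplitConsts) (R : RenConsts) (c : ℝ) (hP : P.WF) (hR2 : R.WF2) (hc : 0 < c)
    (hc3 : c ≤ klEngC₃3 P R) {μ : ℝ} (hμ : μ ∈ klWindowC) {U : ℝ} (hU : 0 < U) (hU3 : U ≤ klEngU₀3 P R c) {β : ℝ} (hβmin : klBetaMin ≤ β)
    (hβc : β ≤ Real.exp (c / U ^ 2)) {K : TrigPolyC4v} (hK : FrameOK R U (nScales β) μ K) (hL3 : klEngL₃ β U ≤ L) (hM3 : klEngM₃ β U L ≤ M)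
    {n : ℕ} (hn1 : 1 ≤ n) {B X : ℝ} (hB0 : 0 ≤ B) (hX0 : 0 ≤ X)
    (hB : ∀ k₁ ∈ klBall L μ 0, ∀ k₂ ∈ klBall L μ 0, ∀ k₃ ∈ klBall L μ 0, ‖klQuarticValue L M β U μ K n 0 1 k₁ k₂ k₃‖ ≤ B)
    (hMom : n ≤ nScales β → ∀ (ω : Fin 4 → Fin (sectorCount (2 * n))) (x₁ : SpaceTimeIdx L M) (j : Fin 3),
      klScale klE0 n * (imagTimeWeight β M ^ 3 * ∑ y : Fin 3 → SpaceTimeIdx L M,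
        spaceTimeDist L M β x₁ (y j) *
          ‖klIsoKernelAt L M β U μ K n n (fun i => ((ω i, ![(0 : Fin 2), 0, 1, 1] i), ![(0 : Fin 2), 1, 0, 1] i)) (Matrix.vecCons x₁ y)‖) ≤ X)
    {m : ℕ} (hnm : n ≤ m) (Ω : Fin 4 → SectorLeg (sectorCount (2 * m))) (x₁ : SpaceTimeIdx L M) :
    fixedTupleL1 L M β 3 (klIsoKernelAt L M β U μ K n m) Ω x₁ ≤ (1 + 9 ^ 4 * klIsoT ^ 4) * (2 ^ 9 * B + 2 ^ 17 * X) := by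
  have hI0 : 0 ≤ klIsoT := klIsoT_nonneg
  have hS0 : 0 ≤ 2 ^ 9 * B + 2 ^ 17 * X := by positivity
  have hn : ∀ (Ω₀ : Fin 4 → SectorLeg (sectorCount (2 * n))) (y₀ : SpaceTimeIdx L M),
      fixedTupleL1 L M β 3 (klIsoKernelAt L M β U μ K n n) Ω₀ y₀ ≤ 2 ^ 9 * B + 2 ^ 17 * X :=
    fun Ω₀ y₀ => fixedTupleL1_klIsoKernelAt_le_numeral_klEng P R c hR2 hc hc3 hμ hU hU3 hβmin hβc hK hL3 hM3 n hn1 hB0 hX0 hB hMom Ω₀ y₀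
  rcases Nat.eq_or_lt_of_le hnm with heq | hlt
  · subst heq
    refine (hn Ω x₁).trans ?_
    have h4 : 0 ≤ 9 ^ 4 * klIsoT ^ 4 * (2 ^ 9 * B + 2 ^ 17 * X) := by positivity
    nlinarith
  · have hΩ : Ω = fun i => (((fun i => (Ω i).1.1) i, (fun i => (Ω i).1.2) i), (fun i => (Ω i).2) i) := by
      funext i; simp
    rw [hΩ]
    have ht := fixedTupleL1_klIsoKernelAt_le_of_coarser_klEng (L := L) (M := M) P R c hP hR2 hc hc3 hμ hU hU3 hβmin hβc hK hL3 hM3 n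
      (Nat.succ_le_of_lt hlt) (fun i => (Ω i).1.2) (fun i => (Ω i).2) (fun i => (Ω i).1.1) hS0 (fun σ y₀ => hn _ y₀) x₁
    refine ht.trans ?_
    nlinarith

end Summit.HubbardSuperconductivity.HubbardSuperconductivity.Theorems.EngineV8

end
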